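import Literature.Probability.NegativeDependence.ExchangeableRayleigh
import Literature.Probability.NegativeDependence.RayleighTranslationDilution
import Literature.Probability.NegativeDependence.StronglyRayleighNegativeAssociation
import HarnessLib

/-!
# The hierarchy NA / CNA / CNA+ and its arrows (Borcea–Brändén–Liggett, Def. 2.7, Remarks 2.3–2.4, Fig. 1)

J. Borcea, P. Brändén, T. M. Liggett, *Negative dependence and the geometry of polynomials*, J. Amer. Math. Soc.
22 (2009) 521–567 (arXiv:0707.2340, held `paper:arxiv-0707.2340`), §2.1. Verbatim (p. 7):

> **Definition 2.7.** A measure `μ ∈ 𝔓_n` is called negatively associated or NA if `∫F dμ ∫G dμ ≥ ∫FG dμ`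
> for any increasing functions `F, G` on `2^𝓝` that depend on disjoint sets of coordinates (cf. Definition 2.8).
> One says that `μ` is conditionally negatively associated or CNA if each measure obtained from `μ` by
> conditioning on some (or none) of the values of the variables is NA. Finally, `μ` is called strongly
> conditionally negatively associated or CNA+ if each measure obtained from `μ` by imposing external fields and
> projections is CNA.
> **Remark 2.3.** It is clear from the definitions that each of the five properties h-NLC, Rayleigh/h-NLC+, NA,
> CNA, CNA+ implies p-NC.
> **Remark 2.4.** As explained in [P], one has the following subordination relations: CNA ⟹ h-NLC and
> CNA+ ⟹ Rayleigh/h-NLC+. In §4.2 and §7 below we show that PHR ⟹ CNA+ and that this implication is strict.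

and Pemantle [Pemantle2000, §2.2 p. 1378]: "Projecting from index set `S` to `S'` and then imposing an external
field (on `S'`) is the same as imposing an external field which is trivial on `S ∖ S'` and then projecting to `S'`.
Thus any sequence of projections and external fields may be written as one external field followed by one
projection. One may define three stronger properties, CNA+, JNRD+ and h-NLC+, which are that the corresponding
properties hold for the given measure and for all measures obtained from the given measure by imposition of an
external field and a projection".

## What is here

The three classes as predicates on (unnormalized, nonnegative) weights `μ : Finset σ → ℝ`, in the vocabulary
of the tree (`ex`, `mass`, `pin`, `extField`, `projectOn`, `DeterminedBy`): `IsNegAssoc`, `IsCNA`,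
`IsCNAPlus`; and the arrows of BBL Fig. 1 that the tree's theorems give:

* `IsCNAPlus.isCNA`, `IsCNA.isNegAssoc` (definitions); `IsNegAssoc.isPairwiseNC` (Remark 2.3: NA ⟹ p-NC);
* `isNegAssoc_projectOn` (NA is closed under projections), `isCNAPlus_extField` / `isCNAPlus_projectOn`
  (CNA+ is closed under external fields and projections), `pin_projectOn` (conditioning commutes with
  projection), hence `isCNAPlus_of_negAssoc_pin_extField`: the conclusion shape of the tree's Theorems 4.9/4.10
  *is* CNA+; so **`StableOrZero.isCNAPlus`** (Thm. 4.9: strongly Rayleigh ⟹ CNA+) and **`IsPHR.isCNAPlus`**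
  (Thm. 4.10: PHR ⟹ CNA+);
* **`IsCNAPlus.isRayleigh`** (Remark 2.4: CNA+ ⟹ Rayleigh), through `isRayleigh_of_forall_isPairwiseNC_extField`
  ("`μ` is Rayleigh iff `g_μ(a·z)` is p-NC for every `a > 0`", BBL §2.1 after Def. 2.5), and
  `IsCNAPlus.isHNLCPlus` (⟹ h-NLC+, with the tree's Prop. 2.2).

Not treated here: CNA ⟹ h-NLC (Pemantle's route through JNRD).

## References

* [BorceaBrandenLiggett2007] J. Borcea, P. Brändén, T. M. Liggett, Negative dependence and the geometry of
  polynomials, J. Amer. Math. Soc. 22 (2009); arXiv:0707.2340 — §2.1 Def. 2.7, Remarks 2.3–2.4, Fig. 1; §4.2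
  Thms. 4.9, 4.10.
* [Pemantle2000] R. Pemantle, Towards a theory of negative dependence, J. Math. Phys. 41 (2000) — §2.1–2.2
  (NA, CNA, CNA+, p-NC; "one external field followed by one projection").
* [FederMihail1992] T. Feder, M. Mihail, Balanced matroids, STOC 1992 — negative association via induction.
-/

noncomputable section

open Finset MvPolynomial
open Literature.Combinatorics.Sahi2008
open Literature.Combinatorics.StablePolynomials

universe u

namespace Literature.Probability.NegativeDependence

variable {σ : Type u} [Fintype σ] [DecidableEq σ]

/-! ## §1 The three classes -/

section Defs

/-- **NA (Def. 2.7)** for a nonnegative weight (unnormalized: `∫FG dμ · μ(Ω) ≤ ∫F dμ ∫G dμ`): for increasing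
`F, G` depending on disjoint sets of coordinates. [cite: BorceaBrandenLiggett2007, §2.1 Def. 2.7;
Pemantle2000, §2.1] -/
def IsNegAssoc (μ : Finset σ → ℝ) : Prop :=
  ∀ ⦃F G : Finset σ → ℝ⦄, Monotone F → Monotone G → ∀ ⦃E₁ E₂ : Finset σ⦄, DeterminedBy F E₁ → DeterminedBy G E₂ →
    Disjoint E₁ E₂ → ex μ (F * G) * mass μ ≤ ex μ F * ex μ G

/-- **CNA (Def. 2.7)**: every conditioning `pin I O μ` ("on some (or none) of the values of the variables") is
NA. [cite: BorceaBrandenLiggett2007, §2.1 Def. 2.7] -/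
def IsCNA (μ : Finset σ → ℝ) : Prop := ∀ I O : Finset σ, IsNegAssoc (pin I O μ)

/-- **CNA+ (Def. 2.7)**: every weight obtained by imposing an external field `a ≥ 0` and a projection is CNA
(one external field followed by one projection suffices, [Pemantle2000, §2.2]).
[cite: BorceaBrandenLiggett2007, §2.1 Def. 2.7; Pemantle2000, §2.2] -/
def IsCNAPlus (μ : Finset σ → ℝ) : Prop :=
  ∀ a : σ → ℝ, (∀ i, 0 ≤ a i) → ∀ S : Finset σ, IsCNA (projectOn S (extField a μ))

/-- Unfolding `IsNegAssoc`. [cite: BorceaBrandenLiggett2007, §2.1 Def. 2.7] -/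
theorem isNegAssoc_iff (μ : Finset σ → ℝ) :
    IsNegAssoc μ ↔ ∀ ⦃F G : Finset σ → ℝ⦄, Monotone F → Monotone G → ∀ ⦃E₁ E₂ : Finset σ⦄, DeterminedBy F E₁ →
      DeterminedBy G E₂ → Disjoint E₁ E₂ → ex μ (F * G) * mass μ ≤ ex μ F * ex μ G := Iff.rfl

/-- Unfolding `IsCNA`. [cite: BorceaBrandenLiggett2007, §2.1 Def. 2.7] -/
theorem isCNA_iff (μ : Finset σ → ℝ) : IsCNA μ ↔ ∀ I O : Finset σ, IsNegAssoc (pin I O μ) := Iff.rfl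

/-- Unfolding `IsCNAPlus`. [cite: BorceaBrandenLiggett2007, §2.1 Def. 2.7] -/
theorem isCNAPlus_iff (μ : Finset σ → ℝ) :
    IsCNAPlus μ ↔ ∀ a : σ → ℝ, (∀ i, 0 ≤ a i) → ∀ S : Finset σ, IsCNA (projectOn S (extField a μ)) := Iff.rfl

/-- The zero weight is NA (both sides vanish). [cite: BorceaBrandenLiggett2007, §2.1 Def. 2.7] -/
theorem isNegAssoc_zero : IsNegAssoc (0 : Finset σ → ℝ) := by
  intro F G _ _ E₁ E₂ _ _ _
  simp [ex_def, mass]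

/-- **CNA ⟹ NA** ("or none": `I = O = ∅`). [cite: BorceaBrandenLiggett2007, §2.1 Def. 2.7] -/
theorem IsCNA.isNegAssoc {μ : Finset σ → ℝ} (h : IsCNA μ) : IsNegAssoc μ := by
  have := h ∅ ∅
  rwa [pin_empty_empty] at this

/-- The projection onto all of `σ` is the identity. [cite: BorceaBrandenLiggett2007, §2.1 (ii)] -/
theorem projectOn_univ (μ : Finset σ → ℝ) : projectOn Finset.univ μ = μ := by
  funext T
  rw [projectOn_apply]
  simp only [Finset.inter_univ]
  rw [Finset.sum_ite_eq' Finset.univ T μ, if_pos (Finset.mem_univ T)]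

/-- **CNA+ ⟹ CNA** (`a ≡ 1`, no projection). [cite: BorceaBrandenLiggett2007, §2.1 Def. 2.7, Fig. 1] -/
theorem IsCNAPlus.isCNA {μ : Finset σ → ℝ} (h : IsCNAPlus μ) : IsCNA μ := by
  have := h (fun _ => 1) (fun _ => zero_le_one) Finset.univ
  rwa [extField_one, projectOn_univ] at this

end Defs

/-! ## §2 NA ⟹ p-NC (Remark 2.3) and `(p-NC)+ ⟹ Rayleigh` -/

section PNC

/-- **Remark 2.3: NA ⟹ p-NC** (`F = 1_{x ∈ S}`, `G = 1_{y ∈ S}` are increasing and depend on `{x}`, `{y}`).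
[cite: BorceaBrandenLiggett2007, §2.1 Remark 2.3; Pemantle2000, §2.1] -/
theorem IsNegAssoc.isPairwiseNC {μ : Finset σ → ℝ} (h : IsNegAssoc μ) : IsPairwiseNC μ := by
  intro x y hxy
  set F : Finset σ → ℝ := fun S => if x ∈ S then 1 else 0 with hF
  set G : Finset σ → ℝ := fun S => if y ∈ S then 1 else 0 with hG
  have hmono : ∀ z : σ, Monotone fun S : Finset σ => if z ∈ S then (1 : ℝ) else 0 := fun z S T hST => by
    dsimp only
    by_cases hz : z ∈ S
    · rw [if_pos hz, if_pos (hST hz)]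
    · rw [if_neg hz]; split_ifs <;> norm_num
  have hdet : ∀ z : σ, DeterminedBy (fun S : Finset σ => if z ∈ S then (1 : ℝ) else 0) {z} := fun z S T hST => by
    have : z ∈ S ↔ z ∈ T := by
      constructor
      · intro hz; have := Finset.mem_inter.2 ⟨hz, Finset.mem_singleton_self z⟩; rw [hST] at this
        exact (Finset.mem_inter.1 this).1
      · intro hz; have := Finset.mem_inter.2 ⟨hz, Finset.mem_singleton_self z⟩; rw [← hST] at this
        exact (Finset.mem_inter.1 this).1
    dsimp only
    by_cases hz : z ∈ S
    · rw [if_pos hz, if_pos (this.1 hz)]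
    · rw [if_neg hz, if_neg (fun h' => hz (this.2 h'))]
  have key := h (hmono x) (hmono y) (hdet x) (hdet y) (Finset.disjoint_singleton.2 hxy)
  have e1 : ex μ ((fun S : Finset σ => if x ∈ S then (1 : ℝ) else 0) * fun S => if y ∈ S then (1 : ℝ) else 0) =
      ∑ S ∈ univ.filter (fun S : Finset σ => x ∈ S ∧ y ∈ S), μ S := by
    rw [ex_def, Finset.sum_filter]
    refine Finset.sum_congr rfl fun S _ => ?_
    simp only [Pi.mul_apply]
    by_cases hx : x ∈ S <;> by_cases hy : y ∈ S <;> simp [hx, hy]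
  have e2 : ∀ z : σ, ex μ (fun S : Finset σ => if z ∈ S then (1 : ℝ) else 0) =
      ∑ S ∈ univ.filter (fun S : Finset σ => z ∈ S), μ S := fun z => by
    rw [ex_def, Finset.sum_filter]
    refine Finset.sum_congr rfl fun S _ => ?_
    by_cases hz : z ∈ S <;> simp [hz]
  rw [e1, e2, e2, mass_def] at key
  exact key

omit [Fintype σ] [DecidableEq σ] in
/-- `(a·x)` with `x ≡ 1` is `a`. [cite: BorceaBrandenLiggett2007, §2.1 Prop. 2.1 (4)] -/
private theorem mul_one_fun (a : σ → ℝ) : (fun i => a i * (1 : ℝ)) = a := funext fun _ => mul_one _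

/-- The Rayleigh expression of `g_μ(a·z)` at `𝟙` is `a_i a_j` times that of `g_μ` at `a` (left side).
[cite: BorceaBrandenLiggett2007, §2.1 Prop. 2.1 (4) (proof: `Δ_{ij}(f(az))(x) = a_i a_j Δ_{ij}(f)(ax)`)] -/
theorem eval_one_lhs_extField (μ : Finset σ → ℝ) (a : σ → ℝ) (i j : σ) :
    MvPolynomial.eval (fun _ => (1 : ℝ)) (multiAffine (derivWeight i (derivWeight j (extField a μ)))) *
        MvPolynomial.eval (fun _ => (1 : ℝ)) (multiAffine (extField a μ)) =
      a i * a j * (MvPolynomial.eval a (multiAffine (derivWeight i (derivWeight j μ))) *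
        MvPolynomial.eval a (multiAffine μ)) := by
  rw [derivWeight_extField, derivWeight_smul, derivWeight_extField, ← mul_smul, eval_multiAffine_smul,
    eval_multiAffine_extField, eval_multiAffine_extField, mul_one_fun]
  ring

/-- The Rayleigh expression of `g_μ(a·z)` at `𝟙` is `a_i a_j` times that of `g_μ` at `a` (right side).
[cite: BorceaBrandenLiggett2007, §2.1 Prop. 2.1 (4)] -/
theorem eval_one_rhs_extField (μ : Finset σ → ℝ) (a : σ → ℝ) (i j : σ) :
    MvPolynomial.eval (fun _ => (1 : ℝ)) (multiAffine (derivWeight i (extField a μ))) *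
        MvPolynomial.eval (fun _ => (1 : ℝ)) (multiAffine (derivWeight j (extField a μ))) =
      a i * a j * (MvPolynomial.eval a (multiAffine (derivWeight i μ)) *
        MvPolynomial.eval a (multiAffine (derivWeight j μ))) := by
  rw [derivWeight_extField, derivWeight_extField, eval_multiAffine_smul, eval_multiAffine_smul,
    eval_multiAffine_extField, eval_multiAffine_extField, mul_one_fun]
  ring

/-- **p-NC gives the Rayleigh inequality at `𝟙`.** [cite: BorceaBrandenLiggett2007, §2.1 (the Rayleigh
inequality at `x` "means" p-NC of `g_μ(x·z)`), Remark 2.3] -/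
theorem IsPairwiseNC.rayleigh_one {μ : Finset σ → ℝ} (h : IsPairwiseNC μ) (i j : σ) :
    MvPolynomial.eval (fun _ => (1 : ℝ)) (multiAffine (derivWeight i (derivWeight j μ))) *
        MvPolynomial.eval (fun _ => (1 : ℝ)) (multiAffine μ) ≤
      MvPolynomial.eval (fun _ => (1 : ℝ)) (multiAffine (derivWeight i μ)) *
        MvPolynomial.eval (fun _ => (1 : ℝ)) (multiAffine (derivWeight j μ)) := by
  rcases eq_or_ne i j with rfl | hij
  · rw [derivWeight_derivWeight_self]
    have hz : multiAffine (0 : Finset σ → ℝ) = 0 := by simp [multiAffine]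
    rw [hz, map_zero, zero_mul]
    exact mul_self_nonneg _
  have key := h hij
  rw [sum_filter_mem_mem_eq_mass_pinIn_pinIn, sum_filter_mem_eq_mass_pinIn, sum_filter_mem_eq_mass_pinIn, ← mass_def]
    at key
  rw [eval_one_multiAffine, eval_one_multiAffine, eval_one_multiAffine, eval_one_multiAffine, mass_derivWeight,
    mass_derivWeight, mass_derivWeight, ← derivWeight_pinIn_of_ne hij.symm, mass_derivWeight]
  exact key

/-- **"`μ` is Rayleigh iff `g_μ(a·z)` is p-NC for every `a > 0`" (the direction used for CNA+ ⟹ Rayleigh).**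
[cite: BorceaBrandenLiggett2007, §2.1 (after Def. 2.5: the Rayleigh inequalities at `x` are the pairwise negative
correlations of the measure with external field `x`), Remark 2.4] -/
theorem isRayleigh_of_forall_isPairwiseNC_extField {μ : Finset σ → ℝ}
    (h : ∀ a : σ → ℝ, (∀ i, 0 < a i) → IsPairwiseNC (extField a μ)) : IsRayleigh μ := by
  rw [isRayleigh_iff]
  intro x hx i j
  have key := (h x hx).rayleigh_one i j
  rw [eval_one_lhs_extField, eval_one_rhs_extField] at key
  exact le_of_mul_le_mul_left key (mul_pos (hx i) (hx j))

/-- Conversely a Rayleigh weight has all `g_μ(a·z)`, `a ≥ 0`, p-NC. [cite: BorceaBrandenLiggett2007, §2.1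
Prop. 2.1 (4), Remark 2.3] -/
theorem IsRayleigh.isPairwiseNC_extField {μ : Finset σ → ℝ} (h : IsRayleigh μ) {a : σ → ℝ} (ha : ∀ i, 0 ≤ a i) :
    IsPairwiseNC (extField a μ) :=
  (isRayleigh_extField h ha).isPairwiseNC

end PNC

/-! ## §3 NA under projections; conditioning commutes with projection -/

section Projection

/-- `∫ H d(proj_S ν) = ∫ H(· ∩ S) dν`. [cite: BorceaBrandenLiggett2007, §2.1 (ii) (projections)] -/
theorem ex_projectOn (S : Finset σ) (ν : Finset σ → ℝ) (H : Finset σ → ℝ) :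
    ex (projectOn S ν) H = ex ν fun U => H (U ∩ S) := by
  rw [ex_def, ex_def]
  simp only [projectOn_apply, Finset.sum_mul]
  rw [Finset.sum_comm]
  refine Finset.sum_congr rfl fun U _ => ?_
  simp only [ite_mul, zero_mul]
  rw [Finset.sum_ite_eq Finset.univ (U ∩ S) fun T => ν U * H T, if_pos (Finset.mem_univ _)]

/-- **NA is closed under projections** (test functions `F(· ∩ S)` are again increasing and determined by the same
coordinates). [cite: Pemantle2000, §2.2 (closure of negative association under projections);
BorceaBrandenLiggett2007, §2.1 Def. 2.7] -/
theorem isNegAssoc_projectOn {ν : Finset σ → ℝ} (h : IsNegAssoc ν) (S : Finset σ) : IsNegAssoc (projectOn S ν) := by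
  intro F G hF hG E₁ E₂ hFE hGE hdisj
  rw [ex_projectOn, ex_projectOn, ex_projectOn, mass_projectOn]
  have hmono : ∀ {H : Finset σ → ℝ}, Monotone H → Monotone fun U : Finset σ => H (U ∩ S) :=
    fun hH U V hUV => hH (Finset.inter_subset_inter_right hUV)
  have hdet : ∀ {H : Finset σ → ℝ} {E : Finset σ}, DeterminedBy H E → DeterminedBy (fun U : Finset σ => H (U ∩ S)) E :=
    fun hH U V hUV => hH _ _ (by rw [Finset.inter_right_comm, hUV, Finset.inter_right_comm])
  exact h (hmono hF) (hmono hG) (hdet hFE) (hdet hGE) hdisj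

/-- **Conditioning commutes with projection**: `pin I O (proj_S ν) = proj_S (pin I (O ∩ S) ν)` if `I ⊆ S`, and
`= 0` otherwise. [cite: Pemantle2000, §2.2 (sequences of closure operations); BorceaBrandenLiggett2007, §2.1] -/
theorem pin_projectOn (I O S : Finset σ) (ν : Finset σ → ℝ) :
    pin I O (projectOn S ν) = if I ⊆ S then projectOn S (pin I (O ∩ S) ν) else 0 := by
  funext T
  split_ifs with hIS
  · rw [pin_apply, projectOn_apply, projectOn_apply]
    by_cases hT : I ⊆ T ∧ Disjoint O T
    · rw [if_pos hT]
      refine Finset.sum_congr rfl fun U _ => ?_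
      by_cases hU : U ∩ S = T
      · rw [if_pos hU, if_pos hU, pin_apply, if_pos]
        refine ⟨fun i hi => ?_, Finset.disjoint_left.2 fun o ho hoU => ?_⟩
        · have := hT.1 hi; rw [← hU] at this; exact (Finset.mem_inter.1 this).1
        · have : o ∈ T := by rw [← hU]; exact Finset.mem_inter.2 ⟨hoU, (Finset.mem_inter.1 ho).2⟩
          exact Finset.disjoint_left.1 hT.2 (Finset.mem_inter.1 ho).1 this
      · rw [if_neg hU, if_neg hU]
    · rw [if_neg hT]
      by_cases hTS : T ⊆ S
      · refine (Finset.sum_eq_zero fun U _ => ?_).symm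
        by_cases hU : U ∩ S = T
        · rw [if_pos hU, pin_apply, if_neg]
          rintro ⟨hIU, hOU⟩
          refine hT ⟨fun i hi => ?_, Finset.disjoint_left.2 fun o ho hoT => ?_⟩
          · rw [← hU]; exact Finset.mem_inter.2 ⟨hIU hi, hIS hi⟩
          · have hoU : o ∈ U := by rw [← hU] at hoT; exact (Finset.mem_inter.1 hoT).1
            exact Finset.disjoint_left.1 hOU (Finset.mem_inter.2 ⟨ho, hTS hoT⟩) hoU
        · rw [if_neg hU]
      · rw [← projectOn_apply, projectOn_eq_zero_of_not_subset _ hTS]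
  · rw [pin_apply, Pi.zero_apply]
    split_ifs with hT
    · by_cases hTS : T ⊆ S
      · exact absurd (hT.1.trans hTS) hIS
      · exact projectOn_eq_zero_of_not_subset _ hTS
    · rfl

/-- **The conclusion shape of Theorems 4.9/4.10 is CNA+**: if every `pin I O (extField a μ)` (`a ≥ 0`) is NA then
`μ` is CNA+. [cite: BorceaBrandenLiggett2007, §2.1 Def. 2.7, §4.2 Thms. 4.9–4.10; Pemantle2000, §2.2] -/
theorem isCNAPlus_of_negAssoc_pin_extField {μ : Finset σ → ℝ}
    (h : ∀ a : σ → ℝ, (∀ i, 0 ≤ a i) → ∀ I O : Finset σ, IsNegAssoc (pin I O (extField a μ))) : IsCNAPlus μ := by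
  intro a ha S I O
  rw [pin_projectOn]
  split_ifs with hIS
  · exact isNegAssoc_projectOn (h a ha I (O ∩ S)) S
  · exact isNegAssoc_zero

/-- **Two projections are one.** [cite: Pemantle2000, §2.2 ("any sequence of projections and external fields
may be written as one external field followed by one projection")] -/
theorem projectOn_projectOn (S T : Finset σ) (μ : Finset σ → ℝ) :
    projectOn S (projectOn T μ) = projectOn (S ∩ T) μ := by
  funext V
  rw [projectOn_apply, projectOn_apply]
  simp only [projectOn_apply]
  have step : ∀ U : Finset σ, (if U ∩ S = V then ∑ W : Finset σ, (if W ∩ T = U then μ W else 0) else 0) =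
      ∑ W : Finset σ, if U ∩ S = V ∧ W ∩ T = U then μ W else 0 := fun U => by
    split_ifs with hU
    · exact Finset.sum_congr rfl fun W _ => by simp only [hU, true_and]
    · exact (Finset.sum_eq_zero fun W _ => by rw [if_neg (fun h => hU h.1)]).symm
  rw [Finset.sum_congr rfl fun U _ => step U, Finset.sum_comm]
  refine Finset.sum_congr rfl fun W _ => ?_
  rw [Finset.sum_eq_single (W ∩ T) (fun U _ hU => if_neg fun h => hU h.2.symm)
    (fun h => absurd (Finset.mem_univ _) h)]
  simp only [and_true, Finset.inter_assoc, Finset.inter_comm T S]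

/-- **A projection followed by an external field is an external field (trivial off `T`) followed by the
projection.** [cite: Pemantle2000, §2.2 ("Projecting from index set `S` to `S'` and then imposing an external
field (on `S'`) is the same as imposing an external field which is trivial on `S ∖ S'` and then projecting")] -/
theorem extField_projectOn (a : σ → ℝ) (T : Finset σ) (μ : Finset σ → ℝ) :
    extField a (projectOn T μ) = projectOn T (extField (fun i => if i ∈ T then a i else 1) μ) := by
  funext V
  rw [extField_apply, projectOn_apply, projectOn_apply, Finset.sum_mul]
  refine Finset.sum_congr rfl fun W _ => ?_
  by_cases hW : W ∩ T = V
  · rw [if_pos hW, if_pos hW, extField_apply, Finset.prod_ite_mem, hW]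
  · rw [if_neg hW, if_neg hW, zero_mul]

omit [Fintype σ] [DecidableEq σ] in
/-- **Two external fields are one.** [cite: Pemantle2000, §2.2] -/
theorem extField_extField (a b : σ → ℝ) (μ : Finset σ → ℝ) :
    extField a (extField b μ) = extField (fun i => a i * b i) μ := by
  funext V
  rw [extField_apply, extField_apply, extField_apply, Finset.prod_mul_distrib]
  ring

/-- **CNA+ is closed under external fields.** [cite: Pemantle2000, §2.2 ("these properties are then by definition
closed under external fields and projections"); BorceaBrandenLiggett2007, §2.1 Def. 2.7] -/
theorem isCNAPlus_extField {μ : Finset σ → ℝ} (h : IsCNAPlus μ) {b : σ → ℝ} (hb : ∀ i, 0 ≤ b i) :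
    IsCNAPlus (extField b μ) := by
  intro a ha S
  rw [extField_extField]
  exact h _ (fun i => mul_nonneg (ha i) (hb i)) S

/-- **CNA+ is closed under projections.** [cite: Pemantle2000, §2.2; BorceaBrandenLiggett2007, §2.1 Def. 2.7] -/
theorem isCNAPlus_projectOn {μ : Finset σ → ℝ} (h : IsCNAPlus μ) (T : Finset σ) : IsCNAPlus (projectOn T μ) := by
  intro a ha S
  rw [extField_projectOn, projectOn_projectOn]
  exact h _ (fun i => by split_ifs; exacts [ha i, zero_le_one]) (S ∩ T)

end Projection

/-! ## §4 The arrows -/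

section Arrows

/-- **Theorem 4.9: strongly Rayleigh ⟹ CNA+.** [cite: BorceaBrandenLiggett2007, §4.2 Thm. 4.9] -/
theorem StableOrZero.isCNAPlus {μ : Finset σ → ℝ} (h : StableOrZero μ) (h0 : ∀ S, 0 ≤ μ S) : IsCNAPlus μ :=
  isCNAPlus_of_negAssoc_pin_extField fun _ ha I O _ _ hF hG _ _ hFE hGE hdisj =>
    h.negAssoc_pin_extField h0 ha I O hF hG hFE hGE hdisj

/-- **Theorem 4.10: PHR ⟹ CNA+.** [cite: BorceaBrandenLiggett2007, §4.2 Thm. 4.10, Remark 2.4] -/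
theorem IsPHR.isCNAPlus {μ : Finset σ → ℝ} (h : IsPHR μ) : IsCNAPlus μ :=
  isCNAPlus_of_negAssoc_pin_extField fun _ ha I O _ _ hF hG _ _ hFE hGE hdisj =>
    h.negAssoc_pin_extField ha I O hF hG hFE hGE hdisj

/-- Homogeneous Rayleigh weights are CNA+. [cite: BorceaBrandenLiggett2007, §4.2 Thm. 4.10 (homogeneous Rayleigh
measures are PHR)] -/
theorem IsRayleigh.isCNAPlus_of_isHomogeneous {μ : Finset σ → ℝ} (h : IsRayleigh μ) (h0 : ∀ S, 0 ≤ μ S)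
    (hhom : IsHomogeneous μ) : IsCNAPlus μ :=
  (isPHR_of_isHomogeneous h h0 hhom).isCNAPlus

/-- **CNA+ ⟹ NA of every external field.** [cite: BorceaBrandenLiggett2007, §2.1 Def. 2.7] -/
theorem IsCNAPlus.isNegAssoc_extField {μ : Finset σ → ℝ} (h : IsCNAPlus μ) {a : σ → ℝ} (ha : ∀ i, 0 ≤ a i) :
    IsNegAssoc (extField a μ) := by
  have := (h a ha Finset.univ).isNegAssoc
  rwa [projectOn_univ] at this

/-- **Remark 2.4: CNA+ ⟹ Rayleigh** (NA of `g_μ(a·z)` ⟹ its p-NC ⟹ the Rayleigh inequality at `a`).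
[cite: BorceaBrandenLiggett2007, §2.1 Remark 2.4; Pemantle2000, §2.2] -/
theorem IsCNAPlus.isRayleigh {μ : Finset σ → ℝ} (h : IsCNAPlus μ) : IsRayleigh μ :=
  isRayleigh_of_forall_isPairwiseNC_extField fun _ ha => (h.isNegAssoc_extField fun i => (ha i).le).isPairwiseNC

/-- **Remark 2.4: CNA+ ⟹ Rayleigh/h-NLC+** (for nonnegative weights, with Prop. 2.2).
[cite: BorceaBrandenLiggett2007, §2.1 Remark 2.4, Prop. 2.2] -/
theorem IsCNAPlus.isHNLCPlus {μ : Finset σ → ℝ} (h : IsCNAPlus μ) (h0 : ∀ S, 0 ≤ μ S) : IsHNLCPlus μ :=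
  h.isRayleigh.isHNLCPlus h0

/-- **Remark 2.3** for CNA+, CNA, NA, Rayleigh: each gives p-NC. [cite: BorceaBrandenLiggett2007, §2.1
Remark 2.3] -/
theorem BorceaBrandenLiggett_remark_2_3 {μ : Finset σ → ℝ} :
    (IsCNAPlus μ → IsPairwiseNC μ) ∧ (IsCNA μ → IsPairwiseNC μ) ∧ (IsNegAssoc μ → IsPairwiseNC μ) ∧
      (IsRayleigh μ → IsPairwiseNC μ) :=
  ⟨fun h => h.isCNA.isNegAssoc.isPairwiseNC, fun h => h.isNegAssoc.isPairwiseNC, fun h => h.isPairwiseNC,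
    fun h => h.isPairwiseNC⟩

end Arrows

end Literature.Probability.NegativeDependence

end
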